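import Mathlib
import Summits.Ventures.PercRepro2.AS3Cases
import Summits.Ventures.PercRepro2.AS3Disjoint

/-!
# NEG-B12 in the kernel: the abstract pinned STEP(1,3) fails for the port of the Fano matroid
(seat mine-b, cell pub-perc-repro2; conjectures/MINE-B.md §12.2)

`absH_zero_two_le` (AS3Cases.lean) says that the row `(0,2)` of the pinned STEP family holds for every
increasing event.  The row `(1,3)` does not: for the clutter
  `𝒲_F = {013, 23, 14, 024, 05, 125, 345}` on `Fin 6`
— the port of the Fano matroid `F₇` at a point (every member plus the port element is a circuit of
`F₇`), a binary clutter with the max-flow–min-cut property — and the pins `O = {3,4,5}`,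
`Y = {0,1,2}`, the counts are `H(1,3) = 1 > 0 = H(2,2)`: the all-blue configuration `γ = Y` has a blue
packing of size `3` (`23`, `14`, `05` through the pins) and red packing exactly `1` (`345`), while no
configuration has red packing `2`, because every member meets `{3,4,5}`.

The counts are computed by `decide` through `packDec`, a decidable recursion equivalent to the
`kDisj` of the generated event (`kDisj_genBy_iff`).
-/

open Finset

namespace Summit.Ventures.PercRepro2

namespace StepZero

open ReimerCube

variable {E : Type*} [DecidableEq E]

/-- decidable packing: `packDec 𝒲 k S` iff `S` contains `k` pairwise disjoint members of `𝒲`,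
chosen greedily member by member (equivalent to `kDisj (genBy 𝒲) k S`, `kDisj_genBy_iff`) -/
def packDec (𝒲 : Finset (Finset E)) : ℕ → Finset E → Prop
  | 0, _ => True
  | k + 1, S => ∃ W ∈ 𝒲, W ⊆ S ∧ packDec 𝒲 k (S \ W)

/-- `packDec` is decidable (recursion on the number of members) -/
instance packDecDecidable (𝒲 : Finset (Finset E)) :
    ∀ (k : ℕ) (S : Finset E), Decidable (packDec 𝒲 k S)
  | 0, _ => isTrue trivial
  | k + 1, S =>
    haveI : ∀ W, Decidable (packDec 𝒲 k (S \ W)) := fun W => packDecDecidable 𝒲 k (S \ W)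
    inferInstanceAs (Decidable (∃ W ∈ 𝒲, W ⊆ S ∧ packDec 𝒲 k (S \ W)))

/-- `k` disjoint members inside `S` (`kDisj` of the generated event) is the decidable recursion -/
theorem kDisj_genBy_iff (𝒲 : Finset (Finset E)) :
    ∀ (k : ℕ) (S : Finset E), kDisj (genBy 𝒲) k S ↔ packDec 𝒲 k S
  | 0, _ => by simp [kDisj, packDec]
  | k + 1, S => by
    constructor
    · rintro ⟨K, L, hK, hL, hKL, hA, hB⟩
      obtain ⟨W, hW, hWK⟩ := hA K le_rfl
      refine ⟨W, hW, hWK.trans hK, ?_⟩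
      rw [← kDisj_genBy_iff 𝒲 k]
      apply incr_kDisj (genBy 𝒲) k _ (hB L le_rfl)
      intro x hx
      exact Finset.mem_sdiff.mpr ⟨hL hx, fun hxW => Finset.disjoint_left.mp hKL (hWK hxW) hx⟩
    · rintro ⟨W, hW, hWS, hrest⟩
      rw [← kDisj_genBy_iff 𝒲 k] at hrest
      exact ⟨W, S \ W, hWS, Finset.sdiff_subset, Finset.disjoint_sdiff,
        fun T hT => ⟨W, hW, hT⟩, fun T hT => incr_kDisj (genBy 𝒲) k hT hrest⟩

open Classical in
/-- the abstract count `absH` of a generated event, through the decidable recursion -/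
theorem absH_genBy_eq (𝒲 : Finset (Finset E)) (O Y : Finset E) (i j : ℕ) :
    absH (genBy 𝒲) O Y i j
      = (Y.powerset.filter (fun γ => packDec 𝒲 i (O ∪ (Y \ γ)) ∧ ¬ packDec 𝒲 (i + 1) (O ∪ (Y \ γ))
          ∧ packDec 𝒲 j (O ∪ γ))).card := by
  unfold absH
  congr 1
  apply Finset.filter_congr
  intro γ _
  unfold pinK
  rw [kDisj_genBy_iff, kDisj_genBy_iff, kDisj_genBy_iff]

/-! ## The Fano port -/

/-- the port of the Fano matroid at a point: `{013, 23, 14, 024, 05, 125, 345}` on `Fin 6` -/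
def fanoPort : Finset (Finset (Fin 6)) :=
  {{0, 1, 3}, {2, 3}, {1, 4}, {0, 2, 4}, {0, 5}, {1, 2, 5}, {3, 4, 5}}

/-- `H(1,3) = 1` for the Fano port with pins `{3,4,5}` -/
theorem fanoPort_H13 : absH (genBy fanoPort) {3, 4, 5} {0, 1, 2} 1 3 = 1 := by
  rw [absH_genBy_eq]
  decide

/-- `H(2,2) = 0` for the Fano port with pins `{3,4,5}` -/
theorem fanoPort_H22 : absH (genBy fanoPort) {3, 4, 5} {0, 1, 2} 2 2 = 0 := by
  rw [absH_genBy_eq]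
  decide

/-- **NEG-B12**: the abstract pinned STEP(1,3) `H(1,3) ≤ H(2,2)` FAILS for the Fano port with pins
`{3,4,5}` — the row `(1,3)` of the STEP family is not a theorem of clutters with pins (while the
row `(0,2)` is, `absH_zero_two_le`). -/
theorem fanoPort_not_step13 :
    ¬ (absH (genBy fanoPort) {3, 4, 5} {0, 1, 2} 1 3 ≤ absH (genBy fanoPort) {3, 4, 5} {0, 1, 2} 2 2) := by
  rw [fanoPort_H13, fanoPort_H22]
  decide

end StepZero

end Summit.Ventures.PercRepro2
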